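import Literature.MathematicalPhysics.QuantumFieldTheory.BalabanImbrieJaffe1984to88.BIJ85Prop511GaugeRG
import Literature.MathematicalPhysics.QuantumFieldTheory.BalabanImbrieJaffe1984to88.BIJ85SigmaPositivity

/-!
# `BalabanImbrieJaffe1984to88.BIJ85Ineq423Torus` — T. Bałaban, J. Imbrie, A. Jaffe, *Renormalization of the Higgs model: minimizers,
propagators and the stability of mean field theory*, Commun. Math. Phys. **97** (1985) 299–329 [BalabanImbrieJaffe1985]: the typed
inequality (4.2.3) `c‖f‖² ≤ ⟨f, σ_kf⟩` (r15's `BIJ85Sect4Statements.GaugeRG.Ineq423 c`) HOLDS for the torus model instance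
`BIJ85Prop511GaugeRG.torusGaugeRG` with SOME constant `c > 0` (per torus, per k) — PROVED; the uniformity in k of (4.2.3) is NOT claimed

statement-level skeleton of published theorems with citation tags; proofs where landed; nothing here is a claim about the Yang–Mills mass gap

PDF held: `paper:balaban1985-cmp97-bij-higgs-minimizers` (journal page = PDF page + 298); pp. 310–311 [PDF 12–13] read on the store's
text layer.

THE PRINTED TEXT.  p. 310 [PDF 12]: *"Using that representation we also establish a uniform, positive lower bound 0 < c ≦ σ_k. (4.2.3)"*;
p. 311 [PDF 13]: *"The quadratic form σ_k simplifies on curls, namely for fields f of the form f = ∂B. In particular ⟨∂B, σ_k∂B⟩ = ⟨B, Δ_kB⟩,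
(4.3.1) which defines an action Δ_k."*

CITATION HEADER (lean-in-tree rule).  Phase-2 proof seat p33 (gen 2) of `lit-balaban` (HOME `run/shared/lean/pub/lit-balaban/`), row
**C1.Eq4.2.3** — r15's decl of record `GaugeRG.Ineq423 (c) : Prop := 0 < c ∧ ∀ f, c·‖f‖² ≤ ⟨f, σ_kf⟩` ((4.2.3) *"at a given constant c"*;
the uniformity in k is `BIJ85Sect7Statements.Thm711`, Theorem 7.1.1) — AT THE TORUS MODEL INSTANCE `torusGaugeRG P hd k w distU Ck normCk`
(seat p30 gen 4: plaquette fields `Plaq P k → ℝ`, `⟨f, g⟩ = Σ_p f_pg_p`, `⟨f, σ_kg⟩ = ⟪toU f, sigmaTorus hd w L^k k (toU g)⟫`, `∂ = curl 1`).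

WHAT IS PROVED.
* `ineq423_torusGaugeRG` — **`∃ c, (torusGaugeRG …).Ineq423 c`**: (4.2.3) holds on every torus `T^{(k)}` of the series with a constant
  depending on the torus and on k, by seat p33's `BIJ85SigmaPositivity.sigmaTorus_coercive` (strict positivity of σ_k from the block
  argument of p. 309 + compactness).  SCOPE: the printed `c` is *"uniform"* (independent of k, and of the volume) — that is Theorem 7.1.1
  via the momentum representation of Sect. 7 and is NOT proved here.
* `deltaForm_torusGaugeRG_ge` / `curl_eq_zero_of_deltaForm_eq_zero` — the consequence for the action Δ_k DEFINED by (4.3.1) (r15's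
  `GaugeRG.DeltaForm B B′ = ⟨∂B, σ_k∂B′⟩`): with the same constant, `c·Σ_p|(∂B)(p)|² ≤ ⟨B, Δ_kB⟩`, so `⟨B, Δ_kB⟩ = 0` only for curl-free
  `B` (per torus, per k).
Standing hypotheses: `k ≤ m + K`, `2 ≤ d`, `w > 0`.  No new `def … : Prop`; theorem-only.  Axioms: {propext, Classical.choice, Quot.sound}.
Unit `lit-balaban-p33` gen 2 (literature-prover-lit-balaban-p33-g2-0), 2026-08-21.
-/

namespace Literature.MathematicalPhysics.QuantumFieldTheory.BalabanImbrieJaffe1984to88.BIJ85Ineq423Torus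

open scoped BigOperators RealInnerProductSpace

open Literature.MathematicalPhysics.QuantumFieldTheory.Balaban1983to89
open LatticeFieldCalculus BIJ85Sect4Statements BIJ85Sigma421Torus BIJ85SigmaPositivity BIJ85Prop511GaugeRG

noncomputable section

variable {P : Params}

/-- the printed lattice factor `η⁻¹ = L^k` is non-zero. [folklore] -/
private theorem Lpow_ne_zero (k : ℕ) : ((P.L : ℝ) ^ k) ≠ 0 :=
  pow_ne_zero k (Nat.cast_ne_zero.mpr P.L_pos.ne')

/-- `‖toU f‖² = Σ_p f_p²`: the Euclidean norm of p30's identification is the instance's `normSqP`. [cite: BalabanImbrieJaffe1985, (2.20) p.305] -/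
theorem norm_toU_sq (k : ℕ) (f : Plaq P k → ℝ) : ‖toU P k f‖ ^ 2 = ∑ p, f p * f p := by
  rw [EuclideanSpace.norm_sq_eq]
  refine Finset.sum_congr rfl fun p _ => ?_
  rw [Real.norm_eq_abs, sq_abs, sq]
  rfl

/-- **(4.2.3) AT THE TORUS INSTANCE, with a per-torus constant**: `∃ c, (torusGaugeRG P hd k w …).Ineq423 c`, i.e. `0 < c` and
`c·Σ_p f_p² ≤ ⟨f, σ_kf⟩` for every unit-lattice plaquette field `f` on `T^{(k)}` — from `BIJ85SigmaPositivity.sigmaTorus_coercive` (σ_k with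
the printed lattice factor `η⁻¹ = L^k`); `k ≤ m + K`, `2 ≤ d`, `w > 0`.  The printed constant is uniform in k (Theorem 7.1.1); that
uniformity is NOT claimed. [cite: BalabanImbrieJaffe1985, (4.2.3) p.310] -/
theorem ineq423_torusGaugeRG (hd : 2 ≤ P.d) {k : ℕ} (hk : k ≤ P.m + P.K) {w : ℝ} (hw : 0 < w)
    (distU Ck : PBond P k → PBond P k → ℝ) (normCk : ℝ) :
    ∃ c : ℝ, (torusGaugeRG P hd k w distU Ck normCk).Ineq423 c := by
  obtain ⟨c₀, hc₀, h⟩ := sigmaTorus_coercive (P := P) hd hk hw (c := (P.L : ℝ) ^ k) (Lpow_ne_zero k)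
  refine ⟨c₀, hc₀, fun f => ?_⟩
  show c₀ * ∑ p, f p * f p ≤ ⟪toU P k f, sigmaTorus (P := P) hd w ((P.L : ℝ) ^ k) k (toU P k f)⟫
  rw [← norm_toU_sq]
  exact h (toU P k f)

/-- The same in unfolded form: `∃ c > 0, ∀ f, c·Σ_p f_p² ≤ ⟨f, σ_kf⟩` for the instance's form `σ`. [cite: BalabanImbrieJaffe1985, (4.2.3) p.310] -/
theorem sigma_torusGaugeRG_ge (hd : 2 ≤ P.d) {k : ℕ} (hk : k ≤ P.m + P.K) {w : ℝ} (hw : 0 < w)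
    (distU Ck : PBond P k → PBond P k → ℝ) (normCk : ℝ) :
    ∃ c : ℝ, 0 < c ∧ ∀ f : Plaq P k → ℝ,
      c * ∑ p, f p * f p ≤ (torusGaugeRG P hd k w distU Ck normCk).sigma f f :=
  ineq423_torusGaugeRG hd hk hw distU Ck normCk

/-- **Δ_k of (4.3.1) at the torus instance is bounded below on curls by the same constant**: `c·Σ_p|(∂B)(p)|² ≤ ⟨B, Δ_kB⟩ = ⟨∂B, σ_k∂B⟩`
(r15's `GaugeRG.DeltaForm`, DEFINED by (4.3.1); per torus, per k). [cite: BalabanImbrieJaffe1985, (4.3.1) p.311] -/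
theorem deltaForm_torusGaugeRG_ge (hd : 2 ≤ P.d) {k : ℕ} (hk : k ≤ P.m + P.K) {w : ℝ} (hw : 0 < w)
    (distU Ck : PBond P k → PBond P k → ℝ) (normCk : ℝ) :
    ∃ c : ℝ, 0 < c ∧ ∀ B : PBond P k → ℝ,
      c * ∑ p, curl 1 B p * curl 1 B p ≤ (torusGaugeRG P hd k w distU Ck normCk).DeltaForm B B := by
  obtain ⟨c, hc, h⟩ := sigma_torusGaugeRG_ge hd hk hw distU Ck normCk
  exact ⟨c, hc, fun B => h (curl 1 B)⟩

/-- Hence `⟨B, Δ_kB⟩ = 0` only for curl-free `B` on the torus: the action Δ_k of (4.3.1) is strictly positive transversally to the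
pure gauges (per torus, per k; `k ≤ m + K`, `2 ≤ d`, `w > 0`). [cite: BalabanImbrieJaffe1985, (4.3.1) p.311] -/
theorem curl_eq_zero_of_deltaForm_eq_zero (hd : 2 ≤ P.d) {k : ℕ} (hk : k ≤ P.m + P.K) {w : ℝ} (hw : 0 < w)
    (distU Ck : PBond P k → PBond P k → ℝ) (normCk : ℝ) {B : PBond P k → ℝ}
    (hB : (torusGaugeRG P hd k w distU Ck normCk).DeltaForm B B = 0) : curl 1 B = 0 := by
  have h0 : ⟪toU P k (curl 1 B), sigmaTorus (P := P) hd w ((P.L : ℝ) ^ k) k (toU P k (curl 1 B))⟫ = 0 := hB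
  have h1 : toU P k (curl 1 B) = 0 := eq_zero_of_inner_sigmaTorus_eq_zero hd hk hw (Lpow_ne_zero k) h0
  rw [← (toU P k).symm_apply_apply (curl 1 B), h1, map_zero]

end

end Literature.MathematicalPhysics.QuantumFieldTheory.BalabanImbrieJaffe1984to88.BIJ85Ineq423Torus
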